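import Mathlib.Analysis.SpecialFunctions.Pow.Real
import Mathlib.Analysis.SpecialFunctions.Trigonometric.DerivHyp
import Mathlib.Topology.Order.Basic

/-!
# Super-isotherm from a vanishing block Binder cumulant (stub `stub_superIsothermOfVanishingBinder`, T1b)

Crux `CoulombImpliesNontrivial` of route `PerfectScreening` (Ising3DConformalLimit), item
stmt-CriticalPhenomena-13885, line `SketchPub`, registered stub T1b. Pure real-analysis bookkeeping on
ABSTRACT data: `β > 0`, `V K : ℕ → ℝ` (block variance `Σ_L` and `K_L = 3Σ_L² − ⟨M_L⁴⟩`),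
`mag : ℝ → ℝ` (the magnetisation `h ↦ m(β_c,h)`), `Eexp L t > 0` (block mgf) and `Etilt L t`
(tilted block mean), subject to
* (T1a-shape) `0 ≤ t ≤ 1`, `π² √(K L/12) sinh² t ≤ 2 ⟹ t·V L/2 ≤ Etilt L t / Eexp L t`;
* (GKS) `Etilt L (βh) ≤ (2L+1)³ · mag h · Eexp L (βh)` for `h ≥ 0`;
* (Var) `c L⁵ ≤ V L ≤ C L⁵` for `L ≥ 1`;
* (Binder) `K L/(V L)² → 0`.
Then for every `A` there is `h₀ > 0` with `A·h^{1/5} < mag h` on `(0, h₀]`.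

Proof. Put `t = βh`, `s = t^{1/5}`, `κ = 1 + 54|A|/(c β^{1/5})`, `L = ⌈κ/s²⌉₊`, so `κ/s² ≤ L ≤ 2κ/s²`
and `L⁵ t² = (L s²)⁵ ≤ 32κ⁵`. With `δ = 1/(128 π² C κ⁵)` and `L₁ ≥ 1` such that `K L/(V L)² ≤ δ²` for
`L ≥ L₁`, take `h₀ = 1/(β L₁⁵)`: for `0 < h ≤ h₀` one has `t ≤ 1`, `s ≤ 1/L₁`, hence `L ≥ 1/s² ≥ L₁`,
`√(K L/12) ≤ δ V L ≤ δ C L⁵`, `sinh t ≤ 2t`, and the T1a condition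
`π² √(K L/12) sinh² t ≤ 4π² δ C L⁵ t² ≤ 128 π² δ C κ⁵ = 1 ≤ 2` holds. The chain
`t c L⁵/2 ≤ t V L/2 ≤ Etilt/Eexp ≤ (2L+1)³ mag h ≤ 27 L³ mag h` gives
`mag h ≥ (c/54) t L² ≥ (c/54) κ² s = (c/54) κ² β^{1/5} h^{1/5} > A h^{1/5}`.
-/

noncomputable section

namespace Summit.CriticalPhenomena.Ising3DConformalLimit.PerfectScreeningCoulombImpliesNontrivial

open Filter
open scoped Topology

/-- `sinh x ≤ 2x` for `0 ≤ x ≤ 1` (from `eˣ ≤ 1 + x + x²` on `|x| ≤ 1` and `e⁻ˣ ≥ 1 - x`). -/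
theorem sinh_le_two_mul_of_le_one {x : ℝ} (h0 : 0 ≤ x) (h1 : x ≤ 1) : Real.sinh x ≤ 2 * x := by
  rw [Real.sinh_eq]
  have h2 : |x| ≤ 1 := by rwa [abs_of_nonneg h0]
  have h3 := Real.abs_exp_sub_one_sub_id_le h2
  have h4 : Real.exp x ≤ 1 + x + x ^ 2 := by
    have := (abs_le.1 h3).2
    linarith
  have h5 : 1 - x ≤ Real.exp (-x) := by
    have := Real.add_one_le_exp (-x)
    linarith
  have h6 : x ^ 2 ≤ x := by nlinarith
  linarith

/-- A real sequence tending to `0` is eventually `≤ ε`, from some index `L₁ ≥ 1` on. -/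
theorem exists_forall_ge_le_of_tendsto_zero {g : ℕ → ℝ} (hg : Tendsto g atTop (𝓝 0)) {ε : ℝ}
    (hε : 0 < ε) : ∃ L₁ : ℕ, 1 ≤ L₁ ∧ ∀ L : ℕ, L₁ ≤ L → g L ≤ ε := by
  have h1 : ∀ᶠ L in atTop, g L < ε := (tendsto_order.1 hg).2 ε hε
  obtain ⟨N, hN⟩ := Filter.eventually_atTop.1 h1
  exact ⟨max N 1, le_max_right _ _, fun L hL => (hN L ((le_max_left _ _).trans hL)).le⟩

/-- Ceiling bookkeeping: for `1 ≤ y`, `L = ⌈y⌉₊` satisfies `1 ≤ L`, `y ≤ L` and `L ≤ 2y`. -/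
theorem one_le_ceil_and_le_and_le {y : ℝ} (hy : 1 ≤ y) :
    1 ≤ ⌈y⌉₊ ∧ y ≤ (⌈y⌉₊ : ℝ) ∧ (⌈y⌉₊ : ℝ) ≤ 2 * y := by
  refine ⟨?_, Nat.le_ceil y, ?_⟩
  · have h : (1 : ℝ) ≤ (⌈y⌉₊ : ℝ) := hy.trans (Nat.le_ceil y)
    exact_mod_cast h
  · have h := Nat.ceil_lt_add_one (zero_le_one.trans hy)
    linarith

/-- The arithmetic of the final chain: from `1 ≤ Lr`, `0 ≤ y ≤ Lr`, `c Lr⁵ ≤ V`,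
`t V/2 ≤ R ≤ (2Lr+1)³ · mag` with `t, c > 0` conclude `(c/54) · t · y² ≤ mag`. -/
theorem mag_lower_of_tilted_chain {t c Lr y V R mag : ℝ} (ht : 0 < t) (hc : 0 < c) (hL1 : 1 ≤ Lr)
    (hy : y ≤ Lr) (hy0 : 0 ≤ y) (hVlo : c * Lr ^ 5 ≤ V) (hT1 : t * V / 2 ≤ R)
    (hS3 : R ≤ (2 * Lr + 1) ^ 3 * mag) :
    c / 54 * (t * y ^ 2) ≤ mag := by
  have hL0 : 0 < Lr := one_pos.trans_le hL1
  have hcube : (2 * Lr + 1) ^ 3 ≤ 27 * Lr ^ 3 := by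
    have h3 : 2 * Lr + 1 ≤ 3 * Lr := by linarith
    calc (2 * Lr + 1) ^ 3 ≤ (3 * Lr) ^ 3 := pow_le_pow_left₀ (by linarith) h3 3
      _ = 27 * Lr ^ 3 := by ring
  have h1 : t * (c * Lr ^ 5) / 2 ≤ (2 * Lr + 1) ^ 3 * mag := by
    have := mul_le_mul_of_nonneg_left hVlo ht.le
    linarith
  have hpos : 0 < t * (c * Lr ^ 5) / 2 := by positivity
  have hmag : 0 < mag := by
    have h2 : 0 < (2 * Lr + 1) ^ 3 * mag := hpos.trans_le h1
    exact pos_of_mul_pos_right h2 (by positivity)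
  have h2 : t * (c * Lr ^ 5) / 2 ≤ 27 * Lr ^ 3 * mag :=
    h1.trans (mul_le_mul_of_nonneg_right hcube hmag.le)
  have h3 : t * c * Lr ^ 2 ≤ 54 * mag := by
    have hL3 : 0 < Lr ^ 3 := pow_pos hL0 3
    have key : Lr ^ 3 * (t * c * Lr ^ 2) ≤ Lr ^ 3 * (54 * mag) := by nlinarith
    exact le_of_mul_le_mul_left key hL3
  have h4 : y ^ 2 ≤ Lr ^ 2 := pow_le_pow_left₀ hy0 hy 2
  have h5 : t * c * y ^ 2 ≤ t * c * Lr ^ 2 := mul_le_mul_of_nonneg_left h4 (mul_pos ht hc).le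
  nlinarith

set_option maxHeartbeats 400000 in
/-- **T1b for abstract data.** Let `β > 0` and `V K : ℕ → ℝ`, `mag : ℝ → ℝ`, `Eexp Etilt : ℕ → ℝ → ℝ`
satisfy `Eexp > 0`, the T1a-shape linear response below the first Lee–Yang zero, GKS block-field
domination, the two-sided `L⁵` block variance and `K L/(V L)² → 0`. Then for every `A` there is `h₀ > 0`
with `A · h^{1/5} < mag h` for `0 < h ≤ h₀`. -/
theorem superIsotherm_of_hypotheses {β : ℝ} (hβ : 0 < β) (V K : ℕ → ℝ) (mag : ℝ → ℝ)
    (Eexp Etilt : ℕ → ℝ → ℝ) (hEpos : ∀ (L : ℕ) (t : ℝ), 0 < Eexp L t)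
    (hT1a : ∀ (L : ℕ) (t : ℝ), 0 ≤ t → t ≤ 1 →
      Real.pi ^ 2 * Real.sqrt (K L / 12) * Real.sinh t ^ 2 ≤ 2 → t * V L / 2 ≤ Etilt L t / Eexp L t)
    (hGKS : ∀ (L : ℕ) (h : ℝ), 0 ≤ h → Etilt L (β * h) ≤ (2 * L + 1) ^ 3 * mag h * Eexp L (β * h))
    (hVar : ∃ c C : ℝ, 0 < c ∧ ∀ L : ℕ, 1 ≤ L → c * (L : ℝ) ^ 5 ≤ V L ∧ V L ≤ C * (L : ℝ) ^ 5)
    (hBinder : Tendsto (fun L : ℕ => K L / (V L) ^ 2) atTop (𝓝 0)) (A : ℝ) :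
    ∃ h₀ : ℝ, 0 < h₀ ∧ ∀ h : ℝ, 0 < h → h ≤ h₀ → A * h ^ ((1:ℝ) / 5) < mag h := by
  obtain ⟨c, C, hc, hV⟩ := hVar
  have hcC : c ≤ C := by
    have h1 := hV 1 le_rfl
    push_cast at h1
    linarith [h1.1, h1.2]
  have hC : 0 < C := hc.trans_le hcC
  -- the constants `b5 = β^{1/5}`, `κ`, `δ`
  obtain ⟨b5, hb5_def⟩ : ∃ b5 : ℝ, b5 = β ^ ((1:ℝ) / 5) := ⟨_, rfl⟩
  have hb5 : 0 < b5 := by rw [hb5_def]; exact Real.rpow_pos_of_pos hβ _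
  obtain ⟨κ, hκ_def⟩ : ∃ κ : ℝ, κ = 1 + 54 * |A| / (c * b5) := ⟨_, rfl⟩
  have hκ1 : 1 ≤ κ := by
    rw [hκ_def]
    have : 0 ≤ 54 * |A| / (c * b5) := by positivity
    linarith
  have hκ0 : 0 < κ := one_pos.trans_le hκ1
  have hκA : A < c / 54 * κ ^ 2 * b5 := by
    have h1 : c / 54 * κ * b5 = c * b5 / 54 + |A| := by
      rw [hκ_def]
      field_simp
    have h2 : c / 54 * κ * b5 ≤ c / 54 * κ ^ 2 * b5 := by
      have hκκ : κ ≤ κ ^ 2 := by nlinarith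
      have hcb : 0 ≤ c / 54 * b5 := by positivity
      have := mul_le_mul_of_nonneg_left hκκ hcb
      nlinarith
    have h3 : A ≤ |A| := le_abs_self A
    have h4 : 0 < c * b5 / 54 := by positivity
    linarith
  obtain ⟨δ, hδ_def⟩ : ∃ δ : ℝ, δ = 1 / (128 * Real.pi ^ 2 * C * κ ^ 5) := ⟨_, rfl⟩
  have hπ : 0 < Real.pi := Real.pi_pos
  have hδ : 0 < δ := by rw [hδ_def]; positivity
  -- `L₁`: from there on the Binder ratio is `≤ δ²`
  obtain ⟨L₁, hL₁1, hL₁⟩ := exists_forall_ge_le_of_tendsto_zero hBinder (pow_pos hδ 2)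
  have hL₁r : (1:ℝ) ≤ L₁ := by exact_mod_cast hL₁1
  have hL₁0 : (0:ℝ) < L₁ := one_pos.trans_le hL₁r
  refine ⟨1 / (β * (L₁:ℝ) ^ 5), by positivity, fun h hh hhle => ?_⟩
  -- `t = βh ∈ (0, 1/L₁⁵] ⊆ (0, 1]`
  have ht0 : 0 < β * h := mul_pos hβ hh
  have htL : β * h ≤ 1 / (L₁:ℝ) ^ 5 := by
    calc β * h ≤ β * (1 / (β * (L₁:ℝ) ^ 5)) := mul_le_mul_of_nonneg_left hhle hβ.le
      _ = 1 / (L₁:ℝ) ^ 5 := by field_simp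
  have ht1 : β * h ≤ 1 := by
    refine htL.trans ?_
    rw [div_le_one (by positivity)]
    exact one_le_pow₀ hL₁r
  -- `s = t^{1/5}`
  obtain ⟨s, hs_def⟩ : ∃ s : ℝ, s = (β * h) ^ ((1:ℝ) / 5) := ⟨_, rfl⟩
  have hs0 : 0 < s := by rw [hs_def]; exact Real.rpow_pos_of_pos ht0 _
  have hs5 : s ^ 5 = β * h := by
    rw [hs_def, one_div]
    exact Real.rpow_inv_natCast_pow ht0.le (by norm_num)
  have hs1 : s ≤ 1 := by rw [hs_def]; exact Real.rpow_le_one ht0.le ht1 (by norm_num)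
  have hsL₁ : s ≤ 1 / L₁ := by
    have h5 : s ^ 5 ≤ (1 / (L₁:ℝ)) ^ 5 := by rw [hs5, div_pow, one_pow]; exact htL
    exact le_of_pow_le_pow_left₀ (by norm_num) (by positivity) h5
  have hsb : s = b5 * h ^ ((1:ℝ) / 5) := by rw [hs_def, hb5_def, Real.mul_rpow hβ.le hh.le]
  -- `y = κ/s² ≥ 1`, `L = ⌈y⌉₊`
  obtain ⟨y, hy_def⟩ : ∃ y : ℝ, y = κ / s ^ 2 := ⟨_, rfl⟩
  have hs20 : 0 < s ^ 2 := pow_pos hs0 2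
  have hs2 : s ^ 2 ≤ 1 := pow_le_one₀ hs0.le hs1
  have hy1 : 1 ≤ y := by
    rw [hy_def, le_div_iff₀ hs20]
    nlinarith
  have hy0 : 0 < y := one_pos.trans_le hy1
  obtain ⟨hL1, hyL, hLy⟩ := one_le_ceil_and_le_and_le hy1
  have hLr1 : (1:ℝ) ≤ ⌈y⌉₊ := by exact_mod_cast hL1
  -- `L ≥ L₁`
  have hLL₁ : L₁ ≤ ⌈y⌉₊ := by
    have h1 : s * L₁ ≤ 1 := by rwa [le_div_iff₀ hL₁0] at hsL₁
    have h2 : (L₁:ℝ) * s ^ 2 ≤ 1 := by nlinarith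
    have h3 : (L₁:ℝ) ≤ y := by
      rw [hy_def, le_div_iff₀ hs20]
      nlinarith
    exact_mod_cast h3.trans hyL
  obtain ⟨hVlo, hVhi⟩ := hV ⌈y⌉₊ hL1
  have hVpos : 0 < V ⌈y⌉₊ := lt_of_lt_of_le (by positivity) hVlo
  -- the T1a condition at `(L, t)`
  have hK : K ⌈y⌉₊ ≤ δ ^ 2 * V ⌈y⌉₊ ^ 2 :=
    (div_le_iff₀ (by positivity)).1 (hL₁ ⌈y⌉₊ hLL₁)
  have hsqrt : Real.sqrt (K ⌈y⌉₊ / 12) ≤ δ * V ⌈y⌉₊ := by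
    rw [Real.sqrt_le_iff]
    refine ⟨by positivity, ?_⟩
    have : 0 ≤ δ ^ 2 * V ⌈y⌉₊ ^ 2 := by positivity
    rw [mul_pow]
    linarith
  have hsinh0 : 0 ≤ Real.sinh (β * h) := Real.sinh_nonneg_iff.2 ht0.le
  have hsinh : Real.sinh (β * h) ≤ 2 * (β * h) := sinh_le_two_mul_of_le_one ht0.le ht1
  have hsinh2 : Real.sinh (β * h) ^ 2 ≤ 4 * (β * h) ^ 2 := by nlinarith
  have hLs : (⌈y⌉₊ : ℝ) * s ^ 2 ≤ 2 * κ := by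
    have h1 : (⌈y⌉₊ : ℝ) ≤ 2 * κ / s ^ 2 := by rw [mul_div_assoc, ← hy_def]; exact hLy
    exact (le_div_iff₀ hs20).1 h1
  have hL5t2 : (⌈y⌉₊ : ℝ) ^ 5 * (β * h) ^ 2 ≤ 32 * κ ^ 5 := by
    calc (⌈y⌉₊ : ℝ) ^ 5 * (β * h) ^ 2 = ((⌈y⌉₊ : ℝ) * s ^ 2) ^ 5 := by rw [← hs5]; ring
      _ ≤ (2 * κ) ^ 5 := pow_le_pow_left₀ (by positivity) hLs 5
      _ = 32 * κ ^ 5 := by ring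
  have hcond : Real.pi ^ 2 * Real.sqrt (K ⌈y⌉₊ / 12) * Real.sinh (β * h) ^ 2 ≤ 2 := by
    have hπ2 : 0 ≤ Real.pi ^ 2 := sq_nonneg _
    calc Real.pi ^ 2 * Real.sqrt (K ⌈y⌉₊ / 12) * Real.sinh (β * h) ^ 2
        ≤ Real.pi ^ 2 * (δ * V ⌈y⌉₊) * (4 * (β * h) ^ 2) :=
          mul_le_mul (mul_le_mul_of_nonneg_left hsqrt hπ2) hsinh2 (sq_nonneg _) (by positivity)
      _ ≤ Real.pi ^ 2 * (δ * (C * (⌈y⌉₊ : ℝ) ^ 5)) * (4 * (β * h) ^ 2) := by gcongr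
      _ = 4 * Real.pi ^ 2 * δ * C * ((⌈y⌉₊ : ℝ) ^ 5 * (β * h) ^ 2) := by ring
      _ ≤ 4 * Real.pi ^ 2 * δ * C * (32 * κ ^ 5) :=
          mul_le_mul_of_nonneg_left hL5t2 (by positivity)
      _ = 1 := by
          rw [hδ_def]
          field_simp
          norm_num
      _ ≤ 2 := one_le_two
  -- the chain
  have hT := hT1a ⌈y⌉₊ (β * h) ht0.le ht1 hcond
  have hR : Etilt ⌈y⌉₊ (β * h) / Eexp ⌈y⌉₊ (β * h) ≤ (2 * (⌈y⌉₊ : ℝ) + 1) ^ 3 * mag h :=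
    (div_le_iff₀ (hEpos ⌈y⌉₊ (β * h))).2 (hGKS ⌈y⌉₊ h hh.le)
  have hmain := mag_lower_of_tilted_chain ht0 hc hLr1 hyL hy0.le hVlo hT hR
  -- `t y² = κ² s`
  have hty : β * h * y ^ 2 = κ ^ 2 * s := by
    rw [hy_def, ← hs5]
    field_simp
  calc A * h ^ ((1:ℝ) / 5) < c / 54 * κ ^ 2 * b5 * h ^ ((1:ℝ) / 5) :=
        mul_lt_mul_of_pos_right hκA (Real.rpow_pos_of_pos hh _)
    _ = c / 54 * (β * h * y ^ 2) := by rw [hty, hsb]; ring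
    _ ≤ mag h := hmain

/-- **T1b — SUPER-ISOTHERM FROM A VANISHING BLOCK BINDER CUMULANT** (registered stub of line `SketchPub`,
crux `CoulombImpliesNontrivial`). Abstract data `β > 0`, `V K : ℕ → ℝ`, `mag : ℝ → ℝ`,
`Eexp Etilt : ℕ → ℝ → ℝ` with `Eexp > 0`, the T1a-shape linear response
(`0 ≤ t ≤ 1`, `π²√(K L/12) sinh² t ≤ 2 ⟹ t V L/2 ≤ Etilt L t/Eexp L t`), GKS block-field domination
(`Etilt L (βh) ≤ (2L+1)³ mag h · Eexp L (βh)`, `h ≥ 0`), the two-sided block variance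
(`cL⁵ ≤ V L ≤ CL⁵`, `L ≥ 1`) and `K L/(V L)² → 0`: then for every `A` there is `h₀ > 0` with
`A·h^{1/5} < mag h` on `(0, h₀]` (`superIsotherm_of_hypotheses`). -/
theorem stub_superIsothermOfVanishingBinder :
    ∀ (β : ℝ), 0 < β → ∀ (V K : ℕ → ℝ) (mag : ℝ → ℝ) (Eexp Etilt : ℕ → ℝ → ℝ),
      (∀ (L : ℕ) (t : ℝ), 0 < Eexp L t) →
      (∀ (L : ℕ) (t : ℝ), 0 ≤ t → t ≤ 1 → Real.pi ^ 2 * Real.sqrt (K L / 12) * Real.sinh t ^ 2 ≤ 2 →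
        t * V L / 2 ≤ Etilt L t / Eexp L t) →
      (∀ (L : ℕ) (h : ℝ), 0 ≤ h → Etilt L (β * h) ≤ (2 * L + 1) ^ 3 * mag h * Eexp L (β * h)) →
      (∃ c C : ℝ, 0 < c ∧ ∀ L : ℕ, 1 ≤ L → c * (L : ℝ) ^ 5 ≤ V L ∧ V L ≤ C * (L : ℝ) ^ 5) →
      Tendsto (fun L : ℕ => K L / (V L) ^ 2) atTop (𝓝 0) →
      ∀ A : ℝ, ∃ h₀ : ℝ, 0 < h₀ ∧ ∀ h : ℝ, 0 < h → h ≤ h₀ → A * h ^ ((1:ℝ) / 5) < mag h :=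
  fun _β hβ V K mag Eexp Etilt hEpos hT1a hGKS hVar hBinder A =>
    superIsotherm_of_hypotheses hβ V K mag Eexp Etilt hEpos hT1a hGKS hVar hBinder A

end Summit.CriticalPhenomena.Ising3DConformalLimit.PerfectScreeningCoulombImpliesNontrivial

end
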